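import Literature.Barriers.AtomisticToContinuum.DisorderedHarmonicChainVariations
import HarnessLib

/-!
# Ajanki–Huveneers 2011: continuity of the phase chain and of its variations on the disorder cube

Companion to `…Variations.lean` (integration-by-parts route to the low-frequency bound (U) of
`…Transfer.lean`; O. Ajanki, F. Huveneers, CMP **301** (2011) 841–883, arXiv:1003.1076). The
integration by parts needs the functionals of the disorder `b ∈ ℝⁿ` built in `…Variations.lean`
(`X_j`, `P_i`, `J_j`, `u_k`, `N_j`, `a_k` and the section derivatives `∂_k X_j`, `∂_k u_j`,
`∂_k P_j`, `∂_k J_j`, `∂_k N_j`) to be integrable against `τ^{⊗n}` and continuous in each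
coordinate. All of them are continuous on the open cube `(-R, R)ⁿ` as soon as `w ≤ w_pc(R)` (the
one-step map `(x, b) ↦ f_b(x)` is jointly continuous while `(πw/2)(1+|b|) < 1`, where the
denominator of (3.10) stays positive); this file PROVES exactly these `ContinuousOn` statements,
by induction along the recursions. No new definitions.

[cite: AjankiHuveneers2011, Lemma 3.2 eq. (3.10) (denominator positive for small `w`); folklore]
-/

noncomputable section

open Real Finset Function Set

namespace Literature.Barriers.AtomisticToContinuum.HeatConduction

section Cube

variable {n : ℕ} {R : ℝ}

/-- The open cube `(-R, R)ⁿ` is open. [folklore] -/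
theorem isOpen_cube (n : ℕ) (R : ℝ) : IsOpen (Set.pi Set.univ fun _ : Fin n => Set.Ioo (-R) R) :=
  isOpen_set_pi Set.finite_univ fun _ _ => isOpen_Ioo

/-- Coordinates of points of the open cube. [folklore] -/
theorem abs_lt_of_mem_cube {b : Fin n → ℝ} (hb : b ∈ Set.pi Set.univ fun _ : Fin n => Set.Ioo (-R) R)
    (i : Fin n) : |b i| < R := by
  have := hb i (Set.mem_univ i)
  exact abs_lt.mpr ⟨this.1, this.2⟩

/-- `|finExt b k| < R` on the open cube (`R > 0`). [folklore] -/
theorem abs_finExt_lt (hR : 0 < R) {b : Fin n → ℝ}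
    (hb : b ∈ Set.pi Set.univ fun _ : Fin n => Set.Ioo (-R) R) (k : ℕ) : |finExt b k| < R := by
  by_cases hk : k < n
  · rw [finExt_of_lt _ hk]; exact abs_lt_of_mem_cube hb _
  · simp only [finExt, hk, ↓reduceDIte, abs_zero]; exact hR

/-- `b ↦ finExt b k` is continuous. [folklore] -/
theorem continuous_finExt (k : ℕ) : Continuous fun b : Fin n → ℝ => finExt b k := by
  by_cases hk : k < n
  · simp only [finExt, hk, ↓reduceDIte]; exact continuous_apply _
  · simp only [finExt, hk, ↓reduceDIte]; exact continuous_const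

end Cube

/-! ### Joint continuity of the one-step map -/

section Step

variable {w R : ℝ}

/-- `(x, b) ↦ f_b(x)` is continuous on `ℝ × {|b| < R}` for `w ≤ w_pc(R)`. [cite: AjankiHuveneers2011, Lemma 3.2 eq. (3.10)] -/
theorem continuousOn_ahStep₂ (hR : 0 ≤ R) (hw0 : 0 ≤ w) (hw : w ≤ pcW R) :
    ContinuousOn (fun p : ℝ × ℝ => ahStep w p.2 p.1) (Set.univ ×ˢ {b : ℝ | |b| < R}) := by
  have hN : Continuous fun p : ℝ × ℝ => ahNum w p.1 p.2 := by
    unfold ahNum; fun_prop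
  have hD : Continuous fun p : ℝ × ℝ => ahDen w p.1 p.2 := by
    unfold ahDen; fun_prop
  have hD0 : ∀ p ∈ Set.univ ×ˢ {b : ℝ | |b| < R}, ahDen w p.1 p.2 ≠ 0 := by
    rintro ⟨x, b⟩ ⟨-, hb⟩
    simp only [Set.mem_setOf_eq] at hb
    obtain ⟨-, hwb, -⟩ := pc_small hR hw0 hw hb.le
    exact (ahDen_pos hw0 hwb).ne'
  have hq : ContinuousOn (fun p : ℝ × ℝ => ahNum w p.1 p.2 / ahDen w p.1 p.2) (Set.univ ×ˢ {b : ℝ | |b| < R}) :=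
    hN.continuousOn.div hD.continuousOn hD0
  have hφ : ContinuousOn (fun p : ℝ × ℝ => ahPhi w p.1 p.2) (Set.univ ×ˢ {b : ℝ | |b| < R}) := by
    unfold ahPhi
    exact (Real.continuous_arctan.comp_continuousOn hq).div_const _
  have : (fun p : ℝ × ℝ => ahStep w p.2 p.1) = fun p => p.1 + ahTheta w + ahPhi w p.1 p.2 := rfl
  rw [this]
  exact (continuous_fst.add continuous_const).continuousOn.add hφ

end Step

/-! ### Continuity on the open cube of the chain and of its variations -/

section Chain

variable {w x R : ℝ} {n : ℕ}


/-- `b ↦ X_j(b)` is continuous on the open cube. [folklore] -/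
theorem continuousOn_ahPhase_pi (hR : 0 < R) (hw0 : 0 ≤ w) (hw : w ≤ pcW R) (x : ℝ) :
    ∀ j, ContinuousOn (fun b : Fin n → ℝ => ahPhase w x (finExt b) j) (Set.pi Set.univ fun _ : Fin n => Set.Ioo (-R) R)
  | 0 => continuousOn_const
  | j + 1 => by
    have ih := continuousOn_ahPhase_pi hR hw0 hw x j
    have hf : ContinuousOn (fun b : Fin n → ℝ => (ahPhase w x (finExt b) j, finExt b j)) (Set.pi Set.univ fun _ : Fin n => Set.Ioo (-R) R) :=
      ih.prodMk (continuous_finExt j).continuousOn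
    have hmaps : Set.MapsTo (fun b : Fin n → ℝ => (ahPhase w x (finExt b) j, finExt b j)) (Set.pi Set.univ fun _ : Fin n => Set.Ioo (-R) R)
        (Set.univ ×ˢ {b : ℝ | |b| < R}) := fun b hb =>
      ⟨Set.mem_univ _, abs_finExt_lt hR hb j⟩
    have h := (continuousOn_ahStep₂ hR.le hw0 hw).comp hf hmaps
    exact h

/-- `(y, δ) ↦ P(y, δ)` is continuous. [folklore] -/
theorem continuous_pcP₂ : Continuous fun p : ℝ × ℝ => pcP p.1 p.2 := by
  unfold pcP; fun_prop

/-- `(y, δ) ↦ P_x(y, δ)` is continuous. [folklore] -/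
theorem continuous_pcPx₂ : Continuous fun p : ℝ × ℝ => pcPx p.1 p.2 := by
  unfold pcPx; fun_prop

/-- `(y, δ) ↦ P_δ(y, δ)` is continuous. [folklore] -/
theorem continuous_pcPd₂ : Continuous fun p : ℝ × ℝ => pcPd p.1 p.2 := by
  unfold pcPd; fun_prop

/-- `b ↦ δ(w, finExt b i)` is continuous. [folklore] -/
theorem continuous_igDelta_finExt (w : ℝ) (i : ℕ) : Continuous fun b : Fin n → ℝ => igDelta w (finExt b i) := by
  unfold igDelta; exact continuous_const.mul (continuous_finExt i)

-- keep the unifier from unfolding the trigonometric polynomials and the chain (expensive `whnf`)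
attribute [local irreducible] pcP pcPx pcPd ahPhase igDelta

/-- `b ↦ P_i(b)` is continuous on the open cube. [folklore] -/
theorem continuousOn_vaP_pi (hR : 0 < R) (hw0 : 0 ≤ w) (hw : w ≤ pcW R) (x : ℝ) (i : ℕ) :
    ContinuousOn (fun b : Fin n → ℝ => vaP w x (finExt b) i) (Set.pi Set.univ fun _ : Fin n => Set.Ioo (-R) R) := by
  unfold vaP
  exact continuous_pcP₂.comp_continuousOn
    ((continuousOn_ahPhase_pi hR hw0 hw x i).prodMk (continuous_igDelta_finExt w i).continuousOn)

/-- `b ↦ u_k(b)` is continuous on the open cube. [folklore] -/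
theorem continuousOn_vaU_pi (hR : 0 < R) (hw0 : 0 ≤ w) (hw : w ≤ pcW R) (x : ℝ) (k : ℕ) :
    ContinuousOn (fun b : Fin n → ℝ => vaU w x (finExt b) k) (Set.pi Set.univ fun _ : Fin n => Set.Ioo (-R) R) := by
  unfold vaU
  exact continuousOn_const.sub (Real.continuous_cos.comp_continuousOn
    (continuousOn_const.mul (continuousOn_ahPhase_pi hR hw0 hw x k)))

/-- `b ↦ J_j(b)` is continuous on the open cube. [folklore] -/
theorem continuousOn_vaJ_pi (hR : 0 < R) (hw0 : 0 ≤ w) (hw : w ≤ pcW R) (x : ℝ) (j : ℕ) :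
    ContinuousOn (fun b : Fin n → ℝ => vaJ w x (finExt b) j) (Set.pi Set.univ fun _ : Fin n => Set.Ioo (-R) R) := by
  unfold vaJ
  refine continuousOn_finsetProd _ fun i _ => ?_
  exact (continuousOn_vaP_pi hR hw0 hw x i).inv₀ fun b _ => (vaP_pos w x _ i).ne'

/-- `b ↦ a_k(b)` is continuous on the open cube. [folklore] -/
theorem continuousOn_vaA_pi (hR : 0 < R) (hw0 : 0 ≤ w) (hw : w ≤ pcW R) (x : ℝ) (k : ℕ) :
    ContinuousOn (fun b : Fin n → ℝ => vaA w x (finExt b) k) (Set.pi Set.univ fun _ : Fin n => Set.Ioo (-R) R) := by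
  unfold vaA
  exact (continuousOn_const.mul (continuousOn_vaJ_pi hR hw0 hw x k)).div_const _

/-- `b ↦ N_j(b)` is continuous on the open cube (`ξ` continuous). [folklore] -/
theorem continuousOn_vaN_pi (hR : 0 < R) (hw0 : 0 ≤ w) (hw : w ≤ pcW R) (x : ℝ) {ξ : ℝ → ℝ}
    (hξ : Continuous ξ) (j : ℕ) :
    ContinuousOn (fun b : Fin n → ℝ => vaN w x (finExt b) ξ j) (Set.pi Set.univ fun _ : Fin n => Set.Ioo (-R) R) := by
  unfold vaN
  refine continuousOn_finsetSum _ fun k _ => ?_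
  exact ((hξ.comp (continuous_finExt k)).continuousOn).mul (continuousOn_vaU_pi hR hw0 hw x k)

/-- `b ↦ a_k(b) ξ(b_k)` is continuous on the open cube. [folklore] -/
theorem continuousOn_vaW_pi (hR : 0 < R) (hw0 : 0 ≤ w) (hw : w ≤ pcW R) (x : ℝ) {ξ : ℝ → ℝ}
    (hξ : Continuous ξ) (k : ℕ) :
    ContinuousOn (fun b : Fin n → ℝ => vaW w x (finExt b) ξ k) (Set.pi Set.univ fun _ : Fin n => Set.Ioo (-R) R) := by
  unfold vaW
  exact (continuousOn_vaA_pi hR hw0 hw x k).mul (hξ.comp (continuous_finExt k)).continuousOn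

/-- `b ↦ ∂X_j/∂B_k(b)` is continuous on the open cube. [folklore] -/
theorem continuousOn_vaDX_pi (hR : 0 < R) (hw0 : 0 ≤ w) (hw : w ≤ pcW R) (x : ℝ) (k : ℕ) :
    ∀ j, ContinuousOn (fun b : Fin n → ℝ => vaDX w x (finExt b) k j) (Set.pi Set.univ fun _ : Fin n => Set.Ioo (-R) R)
  | 0 => by simpa [vaDX] using continuousOn_const
  | j + 1 => by
    rcases lt_trichotomy j k with hjk | rfl | hjk
    · have : (fun b : Fin n → ℝ => vaDX w x (finExt b) k (j + 1)) = fun _ => 0 := by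
        funext b; simp [vaDX, hjk]
      rw [this]; exact continuousOn_const
    · have : (fun b : Fin n → ℝ => vaDX w x (finExt b) j (j + 1)) =
          fun b => igC w * vaU w x (finExt b) j / (π * vaP w x (finExt b) j) := by
        funext b; simp [vaDX]
      rw [this]
      exact (continuousOn_const.mul (continuousOn_vaU_pi hR hw0 hw x j)).div
        (continuousOn_const.mul (continuousOn_vaP_pi hR hw0 hw x j))
        fun b _ => mul_ne_zero Real.pi_ne_zero (vaP_pos w x _ j).ne'
    · have ih := continuousOn_vaDX_pi hR hw0 hw x k j
      have : (fun b : Fin n → ℝ => vaDX w x (finExt b) k (j + 1)) =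
          fun b => vaDX w x (finExt b) k j / vaP w x (finExt b) j := by
        funext b; simp [vaDX, show ¬ (j < k) by omega, show j ≠ k by omega]
      rw [this]
      exact ih.div (continuousOn_vaP_pi hR hw0 hw x j) fun b _ => (vaP_pos w x _ j).ne'

/-- `b ↦ ∂u_j/∂B_k(b)` is continuous on the open cube. [folklore] -/
theorem continuousOn_vaDU_pi (hR : 0 < R) (hw0 : 0 ≤ w) (hw : w ≤ pcW R) (x : ℝ) (k j : ℕ) :
    ContinuousOn (fun b : Fin n → ℝ => vaDU w x (finExt b) k j) (Set.pi Set.univ fun _ : Fin n => Set.Ioo (-R) R) := by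
  unfold vaDU
  refine ContinuousOn.mul ?_ (continuousOn_vaDX_pi hR hw0 hw x k j)
  exact continuousOn_const.mul (Real.continuous_sin.comp_continuousOn
    (continuousOn_const.mul (continuousOn_ahPhase_pi hR hw0 hw x j)))

/-- `b ↦ ∂P_j/∂B_k(b)` is continuous on the open cube. [folklore] -/
theorem continuousOn_vaDP_pi (hR : 0 < R) (hw0 : 0 ≤ w) (hw : w ≤ pcW R) (x : ℝ) (k j : ℕ) :
    ContinuousOn (fun b : Fin n → ℝ => vaDP w x (finExt b) k j) (Set.pi Set.univ fun _ : Fin n => Set.Ioo (-R) R) := by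
  have hXδ : ContinuousOn (fun b : Fin n → ℝ => (ahPhase w x (finExt b) j, igDelta w (finExt b j))) (Set.pi Set.univ fun _ : Fin n => Set.Ioo (-R) R) :=
    (continuousOn_ahPhase_pi hR hw0 hw x j).prodMk (continuous_igDelta_finExt w j).continuousOn
  have h1 : ContinuousOn (fun b : Fin n → ℝ => pcPx (ahPhase w x (finExt b) j) (igDelta w (finExt b j))) (Set.pi Set.univ fun _ : Fin n => Set.Ioo (-R) R) :=
    continuous_pcPx₂.comp_continuousOn hXδ
  have h2 : ContinuousOn (fun b : Fin n → ℝ => pcPd (ahPhase w x (finExt b) j) (igDelta w (finExt b j))) (Set.pi Set.univ fun _ : Fin n => Set.Ioo (-R) R) :=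
    continuous_pcPd₂.comp_continuousOn hXδ
  by_cases hjk : j = k
  · subst hjk
    have hA : ContinuousOn (fun b : Fin n → ℝ =>
        pcPx (ahPhase w x (finExt b) j) (igDelta w (finExt b j)) * vaDX w x (finExt b) j j) (Set.pi Set.univ fun _ : Fin n => Set.Ioo (-R) R) :=
      h1.mul (continuousOn_vaDX_pi hR hw0 hw x j j)
    have hB : ContinuousOn (fun b : Fin n → ℝ =>
        pcPd (ahPhase w x (finExt b) j) (igDelta w (finExt b j)) * igC w) (Set.pi Set.univ fun _ : Fin n => Set.Ioo (-R) R) :=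
      h2.mul continuousOn_const
    have hc : ContinuousOn (fun b : Fin n → ℝ =>
        pcPx (ahPhase w x (finExt b) j) (igDelta w (finExt b j)) * vaDX w x (finExt b) j j +
          pcPd (ahPhase w x (finExt b) j) (igDelta w (finExt b j)) * igC w) (Set.pi Set.univ fun _ : Fin n => Set.Ioo (-R) R) := hA.add hB
    have heq : ∀ b : Fin n → ℝ, vaDP w x (finExt b) j j =
        pcPx (ahPhase w x (finExt b) j) (igDelta w (finExt b j)) * vaDX w x (finExt b) j j +
          pcPd (ahPhase w x (finExt b) j) (igDelta w (finExt b j)) * igC w := fun b => by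
      unfold vaDP; rw [if_pos rfl]
    exact hc.congr fun b _ => heq b
  · have hc : ContinuousOn (fun b : Fin n → ℝ =>
        pcPx (ahPhase w x (finExt b) j) (igDelta w (finExt b j)) * vaDX w x (finExt b) k j) (Set.pi Set.univ fun _ : Fin n => Set.Ioo (-R) R) :=
      h1.mul (continuousOn_vaDX_pi hR hw0 hw x k j)
    have heq : ∀ b : Fin n → ℝ, vaDP w x (finExt b) k j =
        pcPx (ahPhase w x (finExt b) j) (igDelta w (finExt b j)) * vaDX w x (finExt b) k j := fun b => by
      unfold vaDP; rw [if_neg hjk, add_zero]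
    exact hc.congr fun b _ => heq b

/-- `b ↦ ∂J_j/∂B_k(b)` is continuous on the open cube. [folklore] -/
theorem continuousOn_vaDJ_pi (hR : 0 < R) (hw0 : 0 ≤ w) (hw : w ≤ pcW R) (x : ℝ) (k : ℕ) :
    ∀ j, ContinuousOn (fun b : Fin n → ℝ => vaDJ w x (finExt b) k j) (Set.pi Set.univ fun _ : Fin n => Set.Ioo (-R) R)
  | 0 => by simpa [vaDJ] using continuousOn_const
  | j + 1 => by
    have ih := continuousOn_vaDJ_pi hR hw0 hw x k j
    have hP := continuousOn_vaP_pi (n := n) hR hw0 hw x j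
    have hP0 : ∀ b ∈ (Set.pi Set.univ fun _ : Fin n => Set.Ioo (-R) R), vaP w x (finExt b) j ≠ 0 := fun b _ => (vaP_pos w x _ j).ne'
    have : (fun b : Fin n → ℝ => vaDJ w x (finExt b) k (j + 1)) = fun b =>
        vaDJ w x (finExt b) k j * (vaP w x (finExt b) j)⁻¹ +
          vaJ w x (finExt b) j * (-(vaDP w x (finExt b) k j) / vaP w x (finExt b) j ^ 2) := by
      funext b; rfl
    rw [this]
    refine (ih.mul (hP.inv₀ hP0)).add ((continuousOn_vaJ_pi hR hw0 hw x j).mul ?_)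
    exact (continuousOn_vaDP_pi hR hw0 hw x k j).neg.div (hP.pow 2) fun b hb => pow_ne_zero 2 (hP0 b hb)

/-- `b ↦ ∂N_j/∂B_k(b)` is continuous on the open cube (`ξ ∈ C¹`). [folklore] -/
theorem continuousOn_vaDN_pi (hR : 0 < R) (hw0 : 0 ≤ w) (hw : w ≤ pcW R) (x : ℝ) {ξ : ℝ → ℝ}
    (hξ : Continuous ξ) (hξ' : Continuous (deriv ξ)) (k j : ℕ) :
    ContinuousOn (fun b : Fin n → ℝ => vaDN w x (finExt b) ξ k j) (Set.pi Set.univ fun _ : Fin n => Set.Ioo (-R) R) := by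
  unfold vaDN
  refine continuousOn_finsetSum _ fun i _ => ?_
  refine ContinuousOn.add ?_ ?_
  · by_cases hik : i = k
    · subst hik
      have hc : ContinuousOn (fun b : Fin n → ℝ => deriv ξ (finExt b i) * vaU w x (finExt b) i) (Set.pi Set.univ fun _ : Fin n => Set.Ioo (-R) R) :=
        ((hξ'.comp (continuous_finExt i)).continuousOn).mul (continuousOn_vaU_pi hR hw0 hw x i)
      refine hc.congr fun b _ => ?_
      show (if i = i then deriv ξ (finExt b i) * vaU w x (finExt b) i else 0) = _
      rw [if_pos rfl]
    · refine (continuousOn_const (c := (0 : ℝ))).congr fun b _ => ?_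
      show (if i = k then deriv ξ (finExt b i) * vaU w x (finExt b) i else 0) = 0
      rw [if_neg hik]
  · have hc : ContinuousOn (fun b : Fin n → ℝ => ξ (finExt b i) * vaDU w x (finExt b) k i) (Set.pi Set.univ fun _ : Fin n => Set.Ioo (-R) R) :=
      ((hξ.comp (continuous_finExt i)).continuousOn).mul (continuousOn_vaDU_pi hR hw0 hw x k i)
    exact hc

end Chain

end Literature.Barriers.AtomisticToContinuum.HeatConduction

end
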